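import Summits.QuantumFields.YangMills.Theorems.BalabanUVNodesPortU8LocResponse
import Summits.QuantumFields.YangMills.Theorems.BalabanUVNodesPortU8ChartGeneric
import Literature.Analysis.Calculus.SmoothAlongExp

/-!
# PORT PT-B (U8), g4 file 5 — THE JOIN-SIDE RECEIPTS (E1′)(E4a) OF THE CHART-UNIT LOCALIZED CHART, HYPOTHESIS-FREE: ★★ `iotaRowAtLocξ_holds` (`ι_Locξ(W)` is `C²` at `0` and
# vanishes there — in fact `Cⁿ` for every `n`) and ★★★ `responseRowAtLocξ_holds` (`fderiv ℝ (recordEmbLocξ W) 0 (δ_l ⊗ bV a) = recordGkLocWξ W a l`) for EVERY window `W`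
# (in particular `Finset.univ`) — the localized chart is EXPLICIT (`exp ∘ linear`, `mlog ∘ exp` near `0`, port M for the current), so no token enters

Cell `ym-nodeO-ideate` ∕ `ym-balaban-port`, porter `ymgap-nodeO-port-PTB-1` (gen 4).  JOIN-side helper for the decay road of **stmt-QuantumFields-27238** (K0ᴬ),
`--supports stmt-QuantumFields-27238 --as helper` (director-ym №509 (iii′) ∕ №512: the K0ᴬ road's U8-type supply comes from `recordHrLocξ`-objects).  These are the receipts
`K0RecordFormatNames.IotaRowAtLocξ` ∕ `K0RecordFormatNames.ResponseRowAtLocξ` of DEF-1 ed.16c (`…K0RecordFormatNamesLocC`), displayed there «not asserted» — PROVED here outright,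
the (C2a)(C2b)(E4a)-twins for the selector-free data of g4 files 2∕4 (`rowR4D_LocUniv_sandwich`, `response9D_LocUniv_of_tokens`).
[I] = [Balaban1987RG1], [15] = [Balaban1985Variational], [B6] = [Balaban1984PropagatorsII].

WHAT IS PROVED (kernel, sorry-free; at the record's fill `θ := thetaFill F a₀ ε₂₉`, where `ρ₈ = suChartMap 2` is `𝔰𝔲(2)`-valued).
§1 `recordALocξ_add ∕ _smul ∕ _zero` (any `θ`), `recordALocξ_mem_lieSU`, ★ `coe_recordCfgLocξ` (`(W_B(b) : M₂(ℂ)) = exp (A′_B(b))` for EVERY `B` — the retraction `suOfMat` is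
   transparent), `recordCfgLocξ_zero` (`W_0 = 1`), `exists_recordALocξ_clm` (the linear representation as a continuous linear map `B ↦ A′_B`), `hasFDerivAt_coe_recordCfgLocξ`
   (`D(B ↦ W_B)(0) = (B ↦ A′_B)`: `D exp(0) = id`), `contDiffAt_coe_recordCfgLocξ` (`Cⁿ`, every `n`).
§2 `recordEmbLocξ_shape` (`rfl`: the localized chart has the two-block SHAPE of ✓`…PortU8ChartGeneric` over `bg := recordCfgLocξ W`), `contDiffAt_recordEmbLocξ` (every `n`),
   `recordEmbLocξ_zero`, ★★ `iotaRowAtLocξ_holds : IotaRowAtLocξ F θ k K W`.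
§3 ★★★ `responseRowAtLocξ_holds : ResponseRowAtLocξ F θ k K W a` — `𝐔`-coordinates by ✓`fderiv_iota_inl_eq_of_shape` + ✓`recordALocξ_single` + ✓`matrixOf_recordHrLocξ`;
   `𝐉`-coordinates by ✓`fderiv_iota_inr_eq_of_shape` (port M) against the CLOSED FORM ✓`recordJLocξ_eq`.

HONEST FRAMING.  Lattice calculus on explicit objects; no displayed token is used; nothing of Bałaban's analysis is asserted ∕ ported ∕ discharged; 27931 CLOSED · IMPLICATION-ONLY
(unchanged); K0ᴬ 27238 OPEN; NODE O 0∕1; COUNT 8∕28 · K 1∕4 UNMOVED; finite `𝕋⁴_{L^K}` at fixed ε — NOT continuum ∕ OS ∕ Clay; **the Yang–Mills mass gap (Clay) is NOT proved.**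
-/

noncomputable section

open scoped BigOperators Matrix.Norms.L2Operator
open Complex (I)

namespace Summit.QuantumFields.YangMills.Theorems.PortU8

open Literature.MathematicalPhysics.QuantumFieldTheory.Balaban1983to89
open Literature.MathematicalPhysics.QuantumFieldTheory.Balaban1983to89.Node00
open Literature.MathematicalPhysics.QuantumFieldTheory.Balaban1983to89.T4Continuum (T4Family)
open Literature.MathematicalPhysics.QuantumFieldTheory.Balaban1983to89.B12Eq18Current (current)
open Summit.QuantumFields.YangMills.Theorems.K0RecordFormatNames
open NormedSpace (exp)

variable (F : T4Family) (a₀ ε₂₉ : ℝ) (k K : ℕ) (W : Finset (Site (F.P K) (k + 1)))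

/-! ## §1  The linear representation `B ↦ A′_B` and the localized configuration `W_B = exp A′_B` as explicit smooth objects -/

/-- `A′_B` is ADDITIVE in `B` (`ρ₈` is linear). [cite: Balaban1987RG1, (4.2) p.281 (bookkeeping)] -/
theorem recordALocξ_add (θ : Stage13Params F 2) (B B' : Fin (F.P K).d → Site (F.P K) (k + 1) → θ.Vβ) :
    letI := θ.instVβ₁; letI := θ.instVβ₂
    recordALocξ F θ k K W (B + B') = recordALocξ F θ k K W B + recordALocξ F θ k K W B' := by
  letI := θ.instVβ₁; letI := θ.instVβ₂
  funext b
  simp only [recordALocξ, Pi.add_apply, map_add, smul_add, Finset.sum_add_distrib]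

/-- `A′_B` is ℝ-HOMOGENEOUS in `B`. [cite: Balaban1987RG1, (4.2) p.281 (bookkeeping)] -/
theorem recordALocξ_smul (θ : Stage13Params F 2) (t : ℝ) (B : Fin (F.P K).d → Site (F.P K) (k + 1) → θ.Vβ) :
    letI := θ.instVβ₁; letI := θ.instVβ₂
    recordALocξ F θ k K W (t • B) = t • recordALocξ F θ k K W B := by
  letI := θ.instVβ₁; letI := θ.instVβ₂
  funext b
  simp only [recordALocξ, Pi.smul_apply, map_smul, Finset.smul_sum]
  exact Finset.sum_congr rfl fun l _ => by rw [smul_comm]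

/-- `A′_0 = 0`. [cite: Balaban1987RG1, (4.2) p.281 (bookkeeping)] -/
theorem recordALocξ_zero (θ : Stage13Params F 2) :
    letI := θ.instVβ₁; letI := θ.instVβ₂
    recordALocξ F θ k K W 0 = 0 := by
  letI := θ.instVβ₁; letI := θ.instVβ₂
  have h := recordALocξ_smul F k K W θ 0 0
  rwa [zero_smul, zero_smul] at h

/-- At the fill `A′_B(b) ∈ 𝔰𝔲(2)` for EVERY real `B` (a real combination of `ρ₈`-values). [cite: Balaban1987RG1, p.264 (before (1.20)); Hall2015, Example 7.3] -/
theorem recordALocξ_mem_lieSU (B : recordW F a₀ ε₂₉ k K) (b : PBond (F.P K) 0) :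
    recordALocξ F (thetaFill F a₀ ε₂₉) k K W B b ∈ T4AdjointCovarianceUnitary.lieSU (Fin 2) := by
  letI θ := thetaFill F a₀ ε₂₉; letI := θ.instVβ₁; letI := θ.instVβ₂
  unfold recordALocξ
  refine Submodule.sum_mem _ fun l _ => ?_
  rw [Complex.coe_smul]
  exact Submodule.smul_mem _ _ (ρ8_thetaFill_mem_lieSU F a₀ ε₂₉ _)

/-- ★ **`(W_B(b) : M₂(ℂ)) = exp (A′_B(b))` FOR EVERY `B`** — `exp` of an `𝔰𝔲(2)` element is special unitary, so the retraction `suOfMat` is the identity on it.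
[cite: Balaban1987RG1, (3.37) p.277, (4.2) p.281; Hall2015, Example 7.3] -/
theorem coe_recordCfgLocξ (B : recordW F a₀ ε₂₉ k K) (b : PBond (F.P K) 0) :
    ((recordCfgLocξ F (thetaFill F a₀ ε₂₉) k K W B b : SU 2) : MatA 2) = exp (recordALocξ F (thetaFill F a₀ ε₂₉) k K W B b) := by
  have h : recordCfgLocξ F (thetaFill F a₀ ε₂₉) k K W B b = suOfMat 2 (exp (recordALocξ F (thetaFill F a₀ ε₂₉) k K W B b)) := rfl
  rw [h, suOfMat_of_mem (T4AdjointCovarianceUnitary.exp_mem_specialUnitaryGroup_of_mem_lieSU (recordALocξ_mem_lieSU F a₀ ε₂₉ k K W B b))]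

/-- `W_0 = 1`. [cite: Balaban1987RG1, (3.37) p.277 (bookkeeping)] -/
theorem recordCfgLocξ_zero :
    letI θ := thetaFill F a₀ ε₂₉; letI := θ.instVβ₁; letI := θ.instVβ₂
    recordCfgLocξ F θ k K W 0 = 1 := by
  letI θ := thetaFill F a₀ ε₂₉; letI := θ.instVβ₁; letI := θ.instVβ₂
  funext b
  apply Subtype.ext
  rw [coe_recordCfgLocξ, recordALocξ_zero, Pi.zero_apply, NormedSpace.exp_zero]
  rfl

/-- The linear representation `B ↦ A′_B` as a CONTINUOUS LINEAR MAP (finite dimensions). [cite: Balaban1987RG1, (4.2) p.281 (bookkeeping)] -/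
theorem exists_recordALocξ_clm :
    letI θ := thetaFill F a₀ ε₂₉; letI := θ.instVβ₁; letI := θ.instVβ₂
    ∃ L : recordW F a₀ ε₂₉ k K →L[ℝ] (PBond (F.P K) 0 → MatA 2), ∀ B, L B = recordALocξ F θ k K W B := by
  letI θ := thetaFill F a₀ ε₂₉; letI := θ.instVβ₁; letI := θ.instVβ₂; letI := θ.instιβ
  haveI : FiniteDimensional ℝ θ.Vβ := Module.Finite.of_basis θ.bV
  let AL : recordW F a₀ ε₂₉ k K →ₗ[ℝ] (PBond (F.P K) 0 → MatA 2) :=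
    { toFun := fun B => recordALocξ F θ k K W B
      map_add' := fun B B' => recordALocξ_add F k K W θ B B'
      map_smul' := fun t B => recordALocξ_smul F k K W θ t B }
  exact ⟨LinearMap.toContinuousLinearMap AL, fun B => rfl⟩

/-- **`D(B ↦ W_B)(0) = (B ↦ A′_B)`** in `M₂(ℂ)` bondwise (`D exp(0) = id`, `A′` linear, `A′_0 = 0`). [cite: Balaban1987RG1, (3.37) p.277, (4.35) p.290] -/
theorem hasFDerivAt_coe_recordCfgLocξ :
    letI θ := thetaFill F a₀ ε₂₉; letI := θ.instVβ₁; letI := θ.instVβ₂;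
    ∀ (L : recordW F a₀ ε₂₉ k K →L[ℝ] (PBond (F.P K) 0 → MatA 2)), (∀ B, L B = recordALocξ F θ k K W B) →
      HasFDerivAt (fun B : recordW F a₀ ε₂₉ k K => fun b : PBond (F.P K) 0 => ((recordCfgLocξ F θ k K W B b : SU 2) : MatA 2)) L 0 := by
  letI θ := thetaFill F a₀ ε₂₉; letI := θ.instVβ₁; letI := θ.instVβ₂
  intro L hL
  refine hasFDerivAt_pi'.2 fun b => ?_
  have hfun : (fun B : recordW F a₀ ε₂₉ k K => ((recordCfgLocξ F θ k K W B b : SU 2) : MatA 2)) =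
      (exp : MatA 2 → MatA 2) ∘ fun B => (ContinuousLinearMap.proj b).comp L B := by
    funext B; rw [Function.comp_apply, coe_recordCfgLocξ, ContinuousLinearMap.comp_apply, hL]; rfl
  rw [hfun]
  have h0 : ((ContinuousLinearMap.proj b).comp L) 0 = (0 : MatA 2) := map_zero _
  have hexp : HasFDerivAt (exp : MatA 2 → MatA 2) (1 : MatA 2 →L[ℝ] MatA 2) (((ContinuousLinearMap.proj b).comp L) 0) := by
    rw [h0]; exact hasFDerivAt_exp_zero
  have h := hexp.comp (0 : recordW F a₀ ε₂₉ k K) ((ContinuousLinearMap.proj b).comp L).hasFDerivAt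
  rwa [ContinuousLinearMap.one_def, ContinuousLinearMap.id_comp] at h

/-- `B ↦ W_B` is `Cⁿ` at `0` in `M₂(ℂ)` for every `n` (`exp` is analytic, `A′` linear). [cite: Balaban1987RG1, (4.35) p.290; Balaban1985Variational, Prop. 9 p.309] -/
theorem contDiffAt_coe_recordCfgLocξ {n : WithTop ℕ∞} :
    letI θ := thetaFill F a₀ ε₂₉; letI := θ.instVβ₁; letI := θ.instVβ₂
    ContDiffAt ℝ n (fun B : recordW F a₀ ε₂₉ k K => fun b : PBond (F.P K) 0 => ((recordCfgLocξ F θ k K W B b : SU 2) : MatA 2)) 0 := by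
  letI θ := thetaFill F a₀ ε₂₉; letI := θ.instVβ₁; letI := θ.instVβ₂
  obtain ⟨L, hL⟩ := exists_recordALocξ_clm F a₀ ε₂₉ k K W
  refine contDiffAt_pi.2 fun b => ?_
  have hfun : (fun B : recordW F a₀ ε₂₉ k K => ((recordCfgLocξ F θ k K W B b : SU 2) : MatA 2)) =
      (exp : MatA 2 → MatA 2) ∘ fun B => (ContinuousLinearMap.proj b).comp L B := by
    funext B; rw [Function.comp_apply, coe_recordCfgLocξ, ContinuousLinearMap.comp_apply, hL]; rfl
  rw [hfun]
  exact (Literature.Analysis.Calculus.contDiffAt_exp _).comp 0 ((ContinuousLinearMap.proj b).comp L).contDiff.contDiffAt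

/-! ## §2  The localized chart has the SHAPE; it is `Cⁿ` at `0` and vanishes there — receipt (E1′) -/

/-- The chart-unit localized chart has the two-block SHAPE over `bg := recordCfgLocξ W` (definitional). [cite: Balaban1987RG1, (1.8)–(1.9) p.261, (4.35) p.290 (bookkeeping)] -/
theorem recordEmbLocξ_shape (θ : Stage13Params F 2) (B : Fin (F.P K).d → Site (F.P K) (k + 1) → θ.Vβ) (i : Fin (recordChartDimJ F K)) :
    recordEmbLocξ F θ k K W B i = Sum.elim (fun a => sl2Coord (MatrixLog.mlog ((recordCfgLocξ F θ k K W B ((chartEquivJ F K).symm i).1 : SU 2) : MatA 2)) a)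
      (fun a => sl2Coord (current sl2Proj ((F.P K).eta (k + 1)) (fun b => ιSU 2 (recordCfgLocξ F θ k K W B b)) ((chartEquivJ F K).symm i).1) a)
      ((chartEquivJ F K).symm i).2 :=
  rfl

/-- `ι_Locξ(W)` is `Cⁿ` at `0` for every `n`. [cite: Balaban1987RG1, (4.35) p.290; Balaban1985Variational, Prop. 9 p.309] -/
theorem contDiffAt_recordEmbLocξ {n : WithTop ℕ∞} :
    letI θ := thetaFill F a₀ ε₂₉; letI := θ.instVβ₁; letI := θ.instVβ₂
    ContDiffAt ℝ n (recordEmbLocξ F θ k K W) 0 := by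
  letI θ := thetaFill F a₀ ε₂₉; letI := θ.instVβ₁; letI := θ.instVβ₂
  exact contDiffAt_iota_of_shape F k K (recordCfgLocξ F θ k K W) (recordEmbLocξ F θ k K W)
    (recordEmbLocξ_shape F k K W θ) (recordCfgLocξ_zero F a₀ ε₂₉ k K W) (contDiffAt_coe_recordCfgLocξ F a₀ ε₂₉ k K W)

/-- `ι_Locξ(W)(0) = 0`. [cite: Balaban1987RG1, (1.8)–(1.9) p.261, (4.35) p.290] -/
theorem recordEmbLocξ_zero :
    letI θ := thetaFill F a₀ ε₂₉; letI := θ.instVβ₁; letI := θ.instVβ₂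
    recordEmbLocξ F θ k K W 0 = 0 := by
  letI θ := thetaFill F a₀ ε₂₉; letI := θ.instVβ₁; letI := θ.instVβ₂
  exact iota_zero_of_shape F k K (recordCfgLocξ F θ k K W) (recordEmbLocξ F θ k K W)
    (recordEmbLocξ_shape F k K W θ) (recordCfgLocξ_zero F a₀ ε₂₉ k K W)

/-- ★★ **RECEIPT (E1′)-Locξ PROVED, every window `W`**: the chart-unit localized chart is `C²` at `0` and vanishes there. No token, no selector.
[cite: Balaban1987RG1, (4.35) p.290; Balaban1985Variational, Prop. 9 p.309] -/
theorem iotaRowAtLocξ_holds : IotaRowAtLocξ F (thetaFill F a₀ ε₂₉) k K W :=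
  ⟨contDiffAt_recordEmbLocξ F a₀ ε₂₉ k K W, recordEmbLocξ_zero F a₀ ε₂₉ k K W⟩

/-! ## §3  Receipt (E4a): the first derivative of the localized chart on the basis fields IS `recordGkLocWξ` -/

/-- ★★★ **RECEIPT (E4a)-Locξ PROVED, every window `W` and colour `a`**: `fderiv ℝ (recordEmbLocξ W) 0 (δ_l ⊗ bV a) i = recordGkLocWξ W a l i` for every label `l` and
two-block coordinate `i`.  `𝐔`-coordinates: `D(mlog ∘ exp ∘ A′)(0)[δ_l ⊗ bV a](b) = A′_{δ_l ⊗ bV a}(b) = ξ·windowResp W l b · ρ₈(bV a) = Matrix.of (HrLocξ W a l b)`; `𝐉`-coordinates: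
port M's linearised current of the same `M₂(ℂ)`-derivative against the CLOSED FORM ✓`recordJLocξ_eq`. No token, no selector.
[cite: Balaban1987RG1, (4.35) p.290, (1.8)–(1.9) p.261, (3.37) p.277; Balaban1985Variational, Prop. 9 p.309] -/
theorem responseRowAtLocξ_holds (a : (thetaFill F a₀ ε₂₉).ιβ) : ResponseRowAtLocξ F (thetaFill F a₀ ε₂₉) k K W a := by
  letI θ := thetaFill F a₀ ε₂₉; letI := θ.instVβ₁; letI := θ.instVβ₂; letI := θ.instιβ
  intro l i
  obtain ⟨L, hL⟩ := exists_recordALocξ_clm F a₀ ε₂₉ k K W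
  have hU := hasFDerivAt_coe_recordCfgLocξ F a₀ ε₂₉ k K W L hL
  have hE : DifferentiableAt ℝ (recordEmbLocξ F θ k K W) 0 := (contDiffAt_recordEmbLocξ F a₀ ε₂₉ k K W (n := 1)).differentiableAt one_ne_zero
  -- the derivative `U′ (δ_l ⊗ bV a)` IS the matrix family of `HrLocξ W a l`
  have hH : ∀ b' : PBond (F.P K) 0, L (Pi.single l.1 (Pi.single l.2 ((thetaFill F a₀ ε₂₉).bV a))) b' =
      Matrix.of fun i₁ i₂ => recordHrLocξ F (thetaFill F a₀ ε₂₉) k K W a l b' i₁ i₂ := by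
    intro b'
    rw [hL, recordALocξ_single, matrixOf_recordHrLocξ, map_smul, Complex.coe_smul]
  obtain ⟨⟨b, t⟩, rfl⟩ := (chartEquivJ F K).surjective i
  rcases t with c | c
  · rw [fderiv_iota_inl_eq_of_shape F k K (recordCfgLocξ F θ k K W) (recordEmbLocξ F θ k K W) (recordEmbLocξ_shape F k K W θ) (recordCfgLocξ_zero F a₀ ε₂₉ k K W) L hU hE,
      recordGkLocWξ_inl, hH]
  · rw [fderiv_iota_inr_eq_of_shape F k K (recordCfgLocξ F θ k K W) (recordEmbLocξ F θ k K W) (recordEmbLocξ_shape F k K W θ) (recordCfgLocξ_zero F a₀ ε₂₉ k K W) L hU hE,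
      recordGkLocWξ_inr, recordJLocξ_eq]
    simp only [hH]

end Summit.QuantumFields.YangMills.Theorems.PortU8

end
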